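import Summits.CriticalPhenomena.CardyFormulaZ2.Theorems.CardyTensorRGPolyominoGaussianLawSquareLimitFrames
import Literature.Probability.Percolation.OpenPathAnnulusCrossing
import Literature.Probability.Percolation.LatticeSymmetry

/-!
# The bond-`ℤ²` crossing probability of the unit square tends to `1/2` — Part 1:
# a Schramm–Smirnov crossing of a half-integer box is a lattice crossing
# (crux `PolyominoGaussianLaw`, stmt-CriticalPhenomena-14337, route `CardyTensorRG`, line `registered`)

Towards the first polyomino for which the two open cores of the line (dyadic LimitExists and the
identification of the limit) are THEOREMS: the unit square with its corners marked, whose bond-`ℤ²`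
crossing probability tends to `1/2 = I_a(1/2)` (Parts 2–3). The percolation input is
Schramm–Smirnov's continuity (5.1) of quad-crossing events for bond-`ℤ²`, a theorem of the tree
(`SchrammSmirnov2011_lemma_5_1_holds`); the present part is the deterministic dictionary in the
direction "continuum ⇒ lattice":

* `sq_cross_subset_openCrossing` — if a quad `Q ∈ 𝒬_ℂ` has carrier inside the HALF-INTEGER box
  `[(n+½)δ, (n+a-½)δ] × [(m+½)δ, (m+b-½)δ]` and its sides `∂₀Q`, `∂₂Q` on the lines
  `re = (n+½)δ`, `re = (n+a-½)δ`, then every configuration crossing `Q` inside its drawn open edges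
  (`∃ K, Q.IsCrossing K ∧ K ⊆ openEdgeUnion δ ω`) has an open left–right crossing of the lattice box
  `(n, m) + [0, a] × [0, b]`: the open edges drawn through `K` are chained by an open lattice path
  (`openConnIn_of_isPreconnected_subset_openEdgeUnion`), all their ends lie in the box (half-integer
  margins), and the edges through the points of `K` on the two vertical lines are horizontal with an
  end on the extreme columns;
* `sq_real_openCrossing_shift_eq` — that event has probability `crossingProb half a b`.
-/

noncomputable section

open Set Metric Complex MeasureTheory
open scoped unitInterval
open Literature.Probability.LatticeModels Literature.Probability.Percolation
open Literature.Probability.Percolation.QuadCrossing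

namespace Summit.CriticalPhenomena.CardyFormulaZ2.Cruxes.PolyominoGaussianLaw.Birth

/-! ### Lattice bookkeeping -/

/-- Membership in a shifted lattice rectangle. [folklore] -/
theorem sq_mem_shift_rectangle {a b : ℕ} {v z : Site 2} :
    z ∈ (· + v) '' (↑(rectangle a b) : Set (Site 2)) ↔
      v 0 ≤ z 0 ∧ z 0 ≤ v 0 + a ∧ v 1 ≤ z 1 ∧ z 1 ≤ v 1 + b := by
  constructor
  · rintro ⟨y, hy, rfl⟩
    rw [Finset.mem_coe, mem_rectangle_iff] at hy
    simp only [Pi.add_apply]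
    omega
  · rintro ⟨h1, h2, h3, h4⟩
    refine ⟨z - v, ?_, sub_add_cancel z v⟩
    rw [Finset.mem_coe, mem_rectangle_iff]
    simp only [Pi.sub_apply]
    omega

/-- Membership in a shifted left side. [folklore] -/
theorem sq_mem_shift_leftSide {a b : ℕ} {v z : Site 2} :
    z ∈ (· + v) '' (↑(leftSide a b) : Set (Site 2)) ↔
      z 0 = v 0 ∧ v 1 ≤ z 1 ∧ z 1 ≤ v 1 + b := by
  constructor
  · rintro ⟨y, hy, rfl⟩
    rw [Finset.mem_coe, leftSide, Finset.mem_filter, mem_rectangle_iff] at hy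
    simp only [Pi.add_apply]
    omega
  · rintro ⟨h1, h3, h4⟩
    refine ⟨z - v, ?_, sub_add_cancel z v⟩
    rw [Finset.mem_coe, leftSide, Finset.mem_filter, mem_rectangle_iff]
    simp only [Pi.sub_apply]
    omega

/-- Membership in a shifted right side. [folklore] -/
theorem sq_mem_shift_rightSide {a b : ℕ} {v z : Site 2} :
    z ∈ (· + v) '' (↑(rightSide a b) : Set (Site 2)) ↔
      z 0 = v 0 + a ∧ v 1 ≤ z 1 ∧ z 1 ≤ v 1 + b := by
  constructor
  · rintro ⟨y, hy, rfl⟩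
    rw [Finset.mem_coe, rightSide, Finset.mem_filter, mem_rectangle_iff] at hy
    simp only [Pi.add_apply]
    omega
  · rintro ⟨h1, h3, h4⟩
    refine ⟨z - v, ?_, sub_add_cancel z v⟩
    rw [Finset.mem_coe, rightSide, Finset.mem_filter, mem_rectangle_iff]
    simp only [Pi.sub_apply]
    omega

/-- The shifted left–right crossing of `[0, a] × [0, b]` has probability `crossingProb half a b`
(translation invariance of `P_{1/2}`). [folklore] -/
theorem sq_real_openCrossing_shift_eq (a b : ℕ) (v : Site 2) :
    (bondPercolation (zdGraph 2) half).real
        (openCrossing ((· + v) '' (↑(rectangle a b) : Set (Site 2)))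
          ((· + v) '' (↑(leftSide a b) : Set (Site 2)))
          ((· + v) '' (↑(rightSide a b) : Set (Site 2)))) = crossingProb half a b :=
  real_openCrossing_shift half v _ _ _

/-- An integer at least `n - 1/2` (as a real) is at least `n`. [folklore] -/
theorem sq_int_le_of_sub_half_le {n k : ℤ} (h : (n : ℝ) - 1 / 2 ≤ k) : n ≤ k := by
  have h' : (n : ℝ) - 1 < k := by linarith
  have : n - 1 < k := by exact_mod_cast h'
  omega

/-- An integer at most `n + 1/2` (as a real) is at most `n`. [folklore] -/
theorem sq_int_le_of_le_add_half {n k : ℤ} (h : (k : ℝ) ≤ n + 1 / 2) : k ≤ n := by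
  have h' : (k : ℝ) < n + 1 := by linarith
  have : k < n + 1 := by exact_mod_cast h'
  omega

/-- The real part of a point on a drawn lattice edge lies between the real parts of its ends,
and likewise for the imaginary part. [folklore] -/
theorem sq_re_im_mem_of_mem_segment {δ : ℝ} {x y : Site 2} {z : ℂ}
    (hz : z ∈ segment ℝ (meshPoint δ x) (meshPoint δ y)) :
    ∃ θ : ℝ, 0 ≤ θ ∧ θ ≤ 1 ∧ z.re = δ * x 0 + θ * (δ * y 0 - δ * x 0) ∧
      z.im = δ * x 1 + θ * (δ * y 1 - δ * x 1) := by
  rw [segment_eq_image_lineMap] at hz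
  obtain ⟨θ, ⟨h0, h1⟩, rfl⟩ := hz
  refine ⟨θ, h0, h1, ?_, ?_⟩
  · simp only [AffineMap.lineMap_apply_module, Complex.add_re, Complex.smul_re,
      meshPoint_re, smul_eq_mul]
    ring
  · simp only [AffineMap.lineMap_apply_module, Complex.add_im, Complex.smul_im,
      meshPoint_im, smul_eq_mul]
    ring

/-- **An open edge drawn through a point of real part `(n + ½) δ` is horizontal with one end on
column `n`**: some orientation of it, still an edge pair through `K`, has first end on column `n`.
[folklore] -/
theorem sq_exists_edgePair_horizontal {δ : ℝ} (hδ : 0 < δ) {ω : BondConfig (Site 2)} {K : Set ℂ}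
    {p : Site 2 × Site 2} (hp : p ∈ edgePairs δ ω K) {u : ℂ}
    (hu : u ∈ segment ℝ (meshPoint δ p.1) (meshPoint δ p.2)) {n : ℤ} (hre : u.re = (n + 1 / 2) * δ) :
    ∃ q ∈ edgePairs δ ω K, q.1 0 = n ∧ q.2 0 = n + 1 := by
  obtain ⟨θ, h0, h1, hzre, -⟩ := sq_re_im_mem_of_mem_segment hu
  obtain ⟨i, hi | hi⟩ := (zdGraph_adj_iff _ _).1 hp.1
  · -- `p.2 = p.1 + e_i`
    fin_cases i
    · -- horizontal, going right: first end on column `n`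
      have hy' : p.2 0 = p.1 0 + 1 := by
        have := congrFun hi 0
        simpa using this
      refine ⟨p, hp, ?_⟩
      have hy : (p.2 0 : ℝ) = p.1 0 + 1 := by exact_mod_cast hy'
      rw [hy] at hzre
      have e : (n + 1 / 2 : ℝ) = p.1 0 + θ := by
        have : (n + 1 / 2) * δ = (p.1 0 + θ) * δ := by rw [← hre, hzre]; ring
        exact mul_right_cancel₀ hδ.ne' this
      have h3 := sq_int_le_of_sub_half_le (n := n) (k := p.1 0) (by linarith)
      have h4 := sq_int_le_of_le_add_half (n := n) (k := p.1 0) (by linarith)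
      omega
    · -- vertical: impossible
      exfalso
      have hy' : p.2 0 = p.1 0 := by
        have := congrFun hi 0
        simpa using this
      have hy : (p.2 0 : ℝ) = p.1 0 := by exact_mod_cast hy'
      rw [hy, sub_self, mul_zero, add_zero] at hzre
      have e : (n + 1 / 2 : ℝ) = p.1 0 := by
        have : (n + 1 / 2) * δ = (p.1 0 : ℝ) * δ := by rw [← hre, hzre]; ring
        exact mul_right_cancel₀ hδ.ne' this
      have h3 := sq_int_le_of_sub_half_le (n := n) (k := p.1 0) (by linarith)
      have h4 := sq_int_le_of_le_add_half (n := n) (k := p.1 0) (by linarith)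
      have h5 : (p.1 0 : ℝ) = n := by exact_mod_cast le_antisymm h4 h3
      linarith
  · -- `p.1 = p.2 + e_i`
    fin_cases i
    · -- horizontal, going left: the swapped pair has first end on column `n`
      have hy' : p.1 0 = p.2 0 + 1 := by
        have := congrFun hi 0
        simpa using this
      refine ⟨p.swap, swap_mem_edgePairs hp, ?_⟩
      rw [Prod.fst_swap, Prod.snd_swap]
      have hy : (p.1 0 : ℝ) = p.2 0 + 1 := by exact_mod_cast hy'
      rw [hy] at hzre
      have e : (n + 1 / 2 : ℝ) = p.2 0 + 1 - θ := by
        have : (n + 1 / 2) * δ = (p.2 0 + 1 - θ) * δ := by rw [← hre, hzre]; ring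
        exact mul_right_cancel₀ hδ.ne' this
      have h3 := sq_int_le_of_sub_half_le (n := n) (k := p.2 0) (by linarith)
      have h4 := sq_int_le_of_le_add_half (n := n) (k := p.2 0) (by linarith)
      omega
    · exfalso
      have hy' : p.1 0 = p.2 0 := by
        have := congrFun hi 0
        simpa using this
      have hy : (p.1 0 : ℝ) = p.2 0 := by exact_mod_cast hy'
      rw [← hy, sub_self, mul_zero, add_zero] at hzre
      have e : (n + 1 / 2 : ℝ) = p.1 0 := by
        have : (n + 1 / 2) * δ = (p.1 0 : ℝ) * δ := by rw [← hre, hzre]; ring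
        exact mul_right_cancel₀ hδ.ne' this
      have h3 := sq_int_le_of_sub_half_le (n := n) (k := p.1 0) (by linarith)
      have h4 := sq_int_le_of_le_add_half (n := n) (k := p.1 0) (by linarith)
      have h5 : (p.1 0 : ℝ) = n := by exact_mod_cast le_antisymm h4 h3
      linarith

/-! ### A Schramm–Smirnov crossing of a half-integer box is a lattice left–right crossing -/

/-- **Continuum ⇒ lattice.** Let `Q ∈ 𝒬_ℂ` have carrier inside the half-integer box
`[(n+½)δ, (n+a-½)δ] × [(m+½)δ, (m+b-½)δ]` and opposite sides `∂₀Q ⊆ {re = (n+½)δ}`,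
`∂₂Q ⊆ {re = (n+a-½)δ}`. If `ω` crosses `Q` inside its drawn open edges at mesh `δ`, then `ω` has
an open left–right crossing of the lattice box `(n, m) + [0, a] × [0, b]`. [folklore] -/
theorem sq_cross_subset_openCrossing : ∀ {δ : ℝ}, 0 < δ → ∀ {n m : ℤ} {a b : ℕ}
    (Q : Literature.Probability.Percolation.QuadCrossing.Quad (Set.univ : Set ℂ)),
    Q.carrier ⊆ (Set.Icc ((n + 1 / 2) * δ) ((n + a - 1 / 2) * δ) ×ℂ
      Set.Icc ((m + 1 / 2) * δ) ((m + b - 1 / 2) * δ)) →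
    Q.side 0 ⊆ {z : ℂ | z.re = (n + 1 / 2) * δ} →
    Q.side 2 ⊆ {z : ℂ | z.re = (n + a - 1 / 2) * δ} →
    {ω | ∃ K, Q.IsCrossing K ∧ K ⊆ Literature.Probability.Percolation.openEdgeUnion δ ω} ⊆
      Literature.Probability.Percolation.openCrossing
        ((· + (![n, m] : Literature.Probability.LatticeModels.Site 2)) ''
          (↑(Literature.Probability.Percolation.rectangle a b) : Set (Literature.Probability.LatticeModels.Site 2)))
        ((· + (![n, m] : Literature.Probability.LatticeModels.Site 2)) ''
          (↑(Literature.Probability.Percolation.leftSide a b) : Set (Literature.Probability.LatticeModels.Site 2)))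
        ((· + (![n, m] : Literature.Probability.LatticeModels.Site 2)) ''
          (↑(Literature.Probability.Percolation.rightSide a b) : Set (Literature.Probability.LatticeModels.Site 2))) := by
  intro δ hδ n m a b Q hcar h0 h2
  rintro ω ⟨K, ⟨hKc, hKconn, hKsub, ⟨u₀, hu₀K, hu₀s⟩, ⟨u₂, hu₂K, hu₂s⟩⟩, hKO⟩
  set v : Site 2 := ![n, m] with hv
  have hv0 : v 0 = n := rfl
  have hv1 : v 1 = m := rfl
  -- coordinates of the points of `K`
  have hKbox : ∀ z ∈ K, ((n + 1 / 2) * δ ≤ z.re ∧ z.re ≤ (n + a - 1 / 2) * δ) ∧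
      ((m + 1 / 2) * δ ≤ z.im ∧ z.im ≤ (m + b - 1 / 2) * δ) := fun z hz => by
    have h := hcar (hKsub hz)
    rw [mem_reProdIm, mem_Icc, mem_Icc] at h
    exact h
  -- every first end of an open edge drawn through `K` lies in the shifted box
  set S : Set (Site 2) := (· + v) '' (↑(rectangle a b) : Set (Site 2)) with hS_def
  have hS : ∀ p ∈ edgePairs δ ω K, p.1 ∈ S := by
    intro p hp
    obtain ⟨hadj, -, z, hzseg, hzK⟩ := hp
    have hd := dist_meshPoint_le_of_mem_segment hδ hadj hzseg
    obtain ⟨⟨hz1, hz2⟩, hz3, hz4⟩ := hKbox z hzK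
    have hre : |δ * p.1 0 - z.re| ≤ δ := by
      have := abs_re_le_norm (meshPoint δ p.1 - z)
      rw [Complex.sub_re, meshPoint_re] at this
      exact this.trans (by rwa [dist_eq_norm] at hd)
    have him : |δ * p.1 1 - z.im| ≤ δ := by
      have := abs_im_le_norm (meshPoint δ p.1 - z)
      rw [Complex.sub_im, meshPoint_im] at this
      exact this.trans (by rwa [dist_eq_norm] at hd)
    rw [abs_le] at hre him
    rw [hS_def, sq_mem_shift_rectangle, hv0, hv1]
    have e1 : (n : ℝ) - 1 / 2 ≤ p.1 0 := by
      refine le_of_mul_le_mul_left ?_ hδ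
      nlinarith [hre.1]
    have e2 : (p.1 0 : ℝ) ≤ (n + a) + 1 / 2 := by
      refine le_of_mul_le_mul_left ?_ hδ
      nlinarith [hre.2]
    have e3 : (m : ℝ) - 1 / 2 ≤ p.1 1 := by
      refine le_of_mul_le_mul_left ?_ hδ
      nlinarith [him.1]
    have e4 : (p.1 1 : ℝ) ≤ (m + b) + 1 / 2 := by
      refine le_of_mul_le_mul_left ?_ hδ
      nlinarith [him.2]
    have f1 := sq_int_le_of_sub_half_le e1
    have f2 := sq_int_le_of_le_add_half (n := n + a) (k := p.1 0) (by push_cast; exact e2)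
    have f3 := sq_int_le_of_sub_half_le e3
    have f4 := sq_int_le_of_le_add_half (n := m + b) (k := p.1 1) (by push_cast; exact e4)
    exact ⟨f1, f2, f3, f4⟩
  -- the edges through the points of `K` on the two vertical lines
  obtain ⟨p₀, hp₀, hu₀seg⟩ := exists_mem_edgePairs_of_mem hKO hu₀K
  obtain ⟨p₂, hp₂, hu₂seg⟩ := exists_mem_edgePairs_of_mem hKO hu₂K
  obtain ⟨q₀, hq₀, hq₀n, -⟩ := sq_exists_edgePair_horizontal hδ hp₀ hu₀seg (n := n) (h0 hu₀s)
  obtain ⟨q₂', hq₂', -, hq₂n'⟩ := sq_exists_edgePair_horizontal hδ hp₂ hu₂seg (n := n + a - 1)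
    (by rw [h2 hu₂s]; push_cast; ring)
  have hq₂ : q₂'.swap ∈ edgePairs δ ω K := swap_mem_edgePairs hq₂'
  set q₂ := q₂'.swap with hq₂_def
  have hq₂n : q₂.1 0 = n + a := by rw [hq₂_def, Prod.fst_swap, hq₂n']; ring
  -- chain them by an open lattice path through `S`
  have hconn := openConnIn_of_isPreconnected_subset_openEdgeUnion hδ hKc hKconn.isPreconnected hKO
    hS hq₀ hq₂
  have hq₀S := hS q₀ hq₀
  have hq₂S := hS q₂ hq₂
  rw [hS_def, sq_mem_shift_rectangle, hv0, hv1] at hq₀S hq₂S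
  refine ⟨q₀.1, ?_, q₂.1, ?_, hconn⟩
  · rw [sq_mem_shift_leftSide, hv0, hv1]
    exact ⟨hq₀n, hq₀S.2.2.1, hq₀S.2.2.2⟩
  · rw [sq_mem_shift_rightSide, hv0, hv1]
    exact ⟨hq₂n, hq₂S.2.2.1, hq₂S.2.2.2⟩

end Summit.CriticalPhenomena.CardyFormulaZ2.Cruxes.PolyominoGaussianLaw.Birth
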